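import Summits.Ventures.PercRepro.MSTightSingRemovable

/-!
# Contracting the twin classes of a family

Dossier proofs/MINE1-theoremS.md, Addendum 65. The twin relation of a family `F`
(`Twin F a b`: every member contains both or neither) is an equivalence relation
(`twinSetoid`); the **contraction** of a set `t` is its image in the quotient
(`contract F t`), the contraction of a family is the family of contractions (`contractFam`). On
twin-closed sets (members, differences, cells, a near-member and its complement) the contraction
is injective and commutes with `∖`, `∩`, complement and `insert`; hence the contracted family has
the same cardinality, the same difference family (contracted), is tight iff the original is, is
disjoint from its complement family iff the original is, and is **twin-free**. These are the
transport lemmas that reduce Conjecture V to twin-free instances (MSRMStarConjV.lean).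
-/

namespace PercRepro.MSTight

open Finset
open scoped FinsetFamily

variable {α : Type*} [DecidableEq α] [Fintype α]

section Setoid

variable (F : Finset (Finset α))

/-- The twin relation of `F` as a setoid. -/
def twinSetoid : Setoid α where
  r a b := Twin F a b
  iseqv := ⟨fun a => twin_refl F a, fun h => h.symm, fun h₁ h₂ => h₁.trans h₂⟩

/-- The twin relation is decidable. -/
instance : DecidableRel (twinSetoid F).r := fun a b =>
  inferInstanceAs (Decidable (∀ t ∈ F, a ∈ t ↔ b ∈ t))

/-- The contraction of a set along the twin classes of `F`. -/
def contract (t : Finset α) : Finset (Quotient (twinSetoid F)) :=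
  t.image (Quotient.mk (twinSetoid F))

/-- The contraction of a family along the twin classes of `F`. -/
def contractFam (G : Finset (Finset α)) : Finset (Finset (Quotient (twinSetoid F))) :=
  G.image (contract F)

variable {F}

/-- Membership in a contraction. -/
theorem mem_contract {t : Finset α} {x : Quotient (twinSetoid F)} :
    x ∈ contract F t ↔ ∃ a ∈ t, Quotient.mk (twinSetoid F) a = x := by
  simp only [contract, mem_image]

/-- The class of an element of `t` lies in the contraction of `t`. -/
theorem mk_mem_contract_of_mem {t : Finset α} {a : α} (ha : a ∈ t) :
    Quotient.mk (twinSetoid F) a ∈ contract F t :=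
  mem_image_of_mem _ ha

/-- On a twin-closed set, `⟦a⟧ ∈ contract t ↔ a ∈ t`. -/
theorem mk_mem_contract_iff {t : Finset α} (ht : TwinClosed F t) {a : α} :
    Quotient.mk (twinSetoid F) a ∈ contract F t ↔ a ∈ t := by
  constructor
  · intro h
    obtain ⟨b, hb, hab⟩ := mem_contract.1 h
    exact ht b a (Quotient.exact hab) hb
  · exact mk_mem_contract_of_mem

/-- Membership in a contracted family. -/
theorem mem_contractFam {G : Finset (Finset α)} {s : Finset (Quotient (twinSetoid F))} :
    s ∈ contractFam F G ↔ ∃ t ∈ G, contract F t = s := by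
  simp only [contractFam, mem_image]

/-- The contraction of a member lies in the contracted family. -/
theorem contract_mem_contractFam {G : Finset (Finset α)} {t : Finset α} (ht : t ∈ G) :
    contract F t ∈ contractFam F G :=
  mem_image_of_mem _ ht

/-- The contraction is injective on twin-closed sets. -/
theorem contract_inj {s t : Finset α} (hs : TwinClosed F s) (ht : TwinClosed F t)
    (h : contract F s = contract F t) : s = t := by
  ext a
  rw [← mk_mem_contract_iff hs, ← mk_mem_contract_iff ht, h]

/-- The contraction commutes with `∖` on twin-closed sets. -/
theorem contract_sdiff {s t : Finset α} (hs : TwinClosed F s) (ht : TwinClosed F t) :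
    contract F (s \ t) = contract F s \ contract F t := by
  ext x
  obtain ⟨a, rfl⟩ := Quotient.exists_rep x
  rw [mk_mem_contract_iff (hs.sdiff ht), mem_sdiff, mem_sdiff, mk_mem_contract_iff hs,
    mk_mem_contract_iff ht]

/-- The contraction commutes with `∩` on twin-closed sets. -/
theorem contract_inter {s t : Finset α} (hs : TwinClosed F s) (ht : TwinClosed F t) :
    contract F (s ∩ t) = contract F s ∩ contract F t := by
  ext x
  obtain ⟨a, rfl⟩ := Quotient.exists_rep x
  rw [mk_mem_contract_iff (hs.inter ht), mem_inter, mem_inter, mk_mem_contract_iff hs,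
    mk_mem_contract_iff ht]

/-- The contraction of `univ` is `univ`. -/
theorem contract_univ : contract F (univ : Finset α) = univ := by
  ext x
  obtain ⟨a, rfl⟩ := Quotient.exists_rep x
  simp only [mem_univ, iff_true]
  exact mk_mem_contract_of_mem (mem_univ a)

/-- The contraction of `∅` is `∅`. -/
theorem contract_empty : contract F (∅ : Finset α) = ∅ := by
  simp only [contract, image_empty]

/-- The contraction commutes with complementation on twin-closed sets. -/
theorem contract_compl {t : Finset α} (ht : TwinClosed F t) :
    contract F (univ \ t) = univ \ contract F t := by
  rw [contract_sdiff (twinClosed_univ F) ht, contract_univ]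

/-- A contraction is empty iff the set is. -/
theorem contract_eq_empty_iff {t : Finset α} : contract F t = ∅ ↔ t = ∅ := by
  simp only [contract, image_eq_empty]

/-- The contraction of a twin-closed set is `univ` iff the set is. -/
theorem contract_eq_univ_iff {t : Finset α} (ht : TwinClosed F t) :
    contract F t = univ ↔ t = univ := by
  constructor
  · intro h
    have := contract_inj ht (twinClosed_univ F) (by rw [h, contract_univ])
    exact this
  · rintro rfl; exact contract_univ

end Setoid

section Family

variable {F G : Finset (Finset α)}

/-- Every member of `G` is twin-closed for `F`. -/
def FamClosed (F G : Finset (Finset α)) : Prop := ∀ t ∈ G, TwinClosed F t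

omit [DecidableEq α] [Fintype α] in
/-- The members of `F` are twin-closed. -/
theorem famClosed_self : FamClosed F F := fun _ ht => twinClosed_of_mem ht

omit [Fintype α] in
/-- The differences of `F` are twin-closed. -/
theorem famClosed_diffs : FamClosed F (F \\ F) := fun _ hE => twinClosed_of_mem_diffs hE

omit [Fintype α] in
/-- Adding a twin-closed set keeps a family twin-closed. -/
theorem famClosed_insert {u : Finset α} (hu : TwinClosed F u) (hG : FamClosed F G) :
    FamClosed F (insert u G) := by
  intro t ht
  rcases mem_insert.1 ht with rfl | ht
  · exact hu
  · exact hG t ht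

/-- The complement family of a twin-closed family is twin-closed. -/
theorem famClosed_compls (hG : FamClosed F G) : FamClosed F (compls G) := by
  intro t ht
  rw [mem_compls] at ht
  have := (twinClosed_univ F).sdiff (hG _ ht)
  rwa [compl_compl_eq] at this

omit [Fintype α] in
/-- The difference family of a twin-closed family is twin-closed. -/
theorem famClosed_diffs_of (hG : FamClosed F G) : FamClosed F (G \\ G) := by
  intro E hE
  obtain ⟨s, hs, t, ht, rfl⟩ := Finset.mem_diffs.1 hE
  exact (hG s hs).sdiff (hG t ht)

/-- The contraction is injective on families of twin-closed sets. -/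
theorem contractFam_inj {G₁ G₂ : Finset (Finset α)} (h₁ : FamClosed F G₁) (h₂ : FamClosed F G₂)
    (h : contractFam F G₁ = contractFam F G₂) : G₁ = G₂ := by
  ext t
  constructor
  · intro ht
    have := contract_mem_contractFam (F := F) ht
    rw [h] at this
    obtain ⟨t', ht', he⟩ := mem_contractFam.1 this
    rwa [contract_inj (h₂ t' ht') (h₁ t ht) he] at ht'
  · intro ht
    have := contract_mem_contractFam (F := F) ht
    rw [← h] at this
    obtain ⟨t', ht', he⟩ := mem_contractFam.1 this
    rwa [contract_inj (h₁ t' ht') (h₂ t ht) he] at ht'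

/-- The contraction preserves the cardinality of a twin-closed family. -/
theorem card_contractFam (hG : FamClosed F G) : (contractFam F G).card = G.card :=
  card_image_of_injOn fun s hs t ht h => contract_inj (hG s hs) (hG t ht) h

/-- The contraction commutes with `insert`. -/
theorem contractFam_insert (u : Finset α) (G : Finset (Finset α)) :
    contractFam F (insert u G) = insert (contract F u) (contractFam F G) := by
  simp only [contractFam, image_insert]

/-- The difference family of the contraction is the contraction of the difference family. -/
theorem contractFam_diffs (hG : FamClosed F G) :
    contractFam F G \\ contractFam F G = contractFam F (G \\ G) := by
  ext x
  constructor
  · intro hx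
    obtain ⟨s', hs', t', ht', rfl⟩ := Finset.mem_diffs.1 hx
    obtain ⟨s, hs, rfl⟩ := mem_contractFam.1 hs'
    obtain ⟨t, ht, rfl⟩ := mem_contractFam.1 ht'
    rw [← contract_sdiff (hG s hs) (hG t ht)]
    exact contract_mem_contractFam (Finset.sdiff_mem_diffs hs ht)
  · intro hx
    obtain ⟨E, hE, rfl⟩ := mem_contractFam.1 hx
    obtain ⟨s, hs, t, ht, rfl⟩ := Finset.mem_diffs.1 hE
    rw [contract_sdiff (hG s hs) (hG t ht)]
    exact Finset.sdiff_mem_diffs (contract_mem_contractFam hs) (contract_mem_contractFam ht)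

/-- The contraction commutes with the complement family. -/
theorem contractFam_compls (hG : FamClosed F G) :
    contractFam F (compls G) = compls (contractFam F G) := by
  ext x
  constructor
  · intro hx
    obtain ⟨t, ht, rfl⟩ := mem_contractFam.1 hx
    have ht' : TwinClosed F t := famClosed_compls hG t ht
    rw [mem_compls] at ht
    rw [mem_compls, ← contract_compl ht']
    exact contract_mem_contractFam ht
  · intro hx
    rw [mem_compls] at hx
    obtain ⟨t, ht, he⟩ := mem_contractFam.1 hx
    have : x = contract F (univ \ t) := by rw [contract_compl (hG t ht), he, compl_compl_eq]
    rw [this]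
    exact contract_mem_contractFam (compl_mem_compls ht)

/-- Tightness is preserved and reflected by the contraction. -/
theorem tight_contractFam_iff (hG : FamClosed F G) : Tight (contractFam F G) ↔ Tight G := by
  unfold Tight
  rw [contractFam_diffs hG, card_contractFam hG, card_contractFam (famClosed_diffs_of hG)]

/-- The contraction preserves the number of differences. -/
theorem card_diffs_contractFam (hG : FamClosed F G) :
    (contractFam F G \\ contractFam F G).card = (G \\ G).card := by
  rw [contractFam_diffs hG, card_contractFam (famClosed_diffs_of hG)]

/-- The contracted family is twin-free. -/
theorem twin_contractFam_eq {x y : Quotient (twinSetoid F)} (h : Twin (contractFam F F) x y) :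
    x = y := by
  obtain ⟨a, rfl⟩ := Quotient.exists_rep x
  obtain ⟨b, rfl⟩ := Quotient.exists_rep y
  apply Quotient.sound
  intro t ht
  have := h _ (contract_mem_contractFam (F := F) ht)
  rwa [mk_mem_contract_iff (twinClosed_of_mem ht), mk_mem_contract_iff (twinClosed_of_mem ht)]
    at this

/-- Validity (no complementary pair) is preserved by the contraction. -/
theorem disjoint_contractFam_compls (hval : Disjoint F (compls F)) :
    Disjoint (contractFam F F) (compls (contractFam F F)) := by
  rw [← contractFam_compls famClosed_self]
  refine Finset.disjoint_left.2 fun x hx hx' => ?_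
  obtain ⟨s, hs, rfl⟩ := mem_contractFam.1 hx
  obtain ⟨t, ht, he⟩ := mem_contractFam.1 hx'
  have : t = s := contract_inj (famClosed_compls famClosed_self t ht) (twinClosed_of_mem hs) he
  subst this
  exact Finset.disjoint_left.1 hval hs ht

/-- A twin-closed non-member contracts to a non-member. -/
theorem contract_notMem {u : Finset α} (hu : TwinClosed F u) (h : u ∉ F) :
    contract F u ∉ contractFam F F := fun hm => by
  obtain ⟨t, ht, he⟩ := mem_contractFam.1 hm
  exact h (contract_inj (twinClosed_of_mem ht) hu he ▸ ht)

/-- Cells of twin-closed sets contract to cells. -/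
theorem cells_contract {t v : Finset α} (ht : TwinClosed F t) (hv : TwinClosed F v)
    (h : Cells (F \\ F) t v) :
    Cells (contractFam F F \\ contractFam F F) (contract F t) (contract F v) := by
  rw [contractFam_diffs famClosed_self]
  refine ⟨?_, ?_⟩
  · rw [← contract_inter ht hv]
    exact contract_mem_contractFam h.1
  · rw [← contract_compl ht, ← contract_compl hv,
      ← contract_inter ((twinClosed_univ F).sdiff ht) ((twinClosed_univ F).sdiff hv)]
    exact contract_mem_contractFam h.2

/-- The saturation of a set of classes: the union of the classes. -/
def saturate (F : Finset (Finset α)) (s : Finset (Quotient (twinSetoid F))) : Finset α :=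
  univ.filter fun a => Quotient.mk (twinSetoid F) a ∈ s

/-- Saturating the contraction of a twin-closed set gives the set back. -/
theorem saturate_contract {t : Finset α} (ht : TwinClosed F t) : saturate F (contract F t) = t := by
  ext a
  simp only [saturate, mem_filter, mem_univ, true_and]
  exact mk_mem_contract_iff ht

end Family

end PercRepro.MSTight
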